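import Summits.Parity.GeneralizedHardyLittlewood.Theorems.GreenTaoLevelTwoGITwoCyclicInverseLocalQuadraticData

/-!
# Route `GreenTaoLevelTwo`, crux `GITwo` (stmt-Parity-21275), line `birth`, stub `stub_cyclicInverse`:
# localising the local quadratic correlation to a tiny regular Bohr set (GT08a arXiv §10/§12)

Helper toward the XL stub `stub_cyclicInverse` (B. Green, T. Tao, *An inverse theorem for the Gowers
`U³(G)` norm*, arXiv:math/0503014, Thm. 68 = PEMS 51 (2008) Thm. 12.8).  Block E17, first plumbing step.
The bracket form of the phase `M(x)·x` (arXiv Prop. 54, tree `stdAddChar_mul_self_eq_prod_bracket`) is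
available only on a Bohr set `B(S',ρ)` with `ρ · 2^{d(d+2)} d² < ρ₄` (`d = #S'`, `μ` additive on
`B(S',ρ₄)`), much smaller than the regular Bohr set `B(S',ρ₅)` carrying the correlation of §9.  As in the
paper ("by Lemma (avg) and the pigeonhole principle") one passes to a translate of a tiny REGULAR Bohr set
`B(S',ρ₆)`, `ρ₆ ≍ k ρ₅ /(d³ 2^{d(d+2)})`, losing a factor `2` in the correlation.  Def-free:

* `exists_translate_correlation_of_regular` — arXiv Lemma 21 (ii) + pigeonhole: a correlation
  `K #B ≤ ‖∑_{x∈B} G x‖` on a regular Bohr set `B = B(S,ρ)` gives a translate `x ∈ B` with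
  `(K − 200 d ε) #A ≤ ‖∑_{y ∈ A} G(x+y)‖` for every nonempty `A ⊆ B(S, ερ)`;
* `stdAddChar_local_phase_split` — the algebra `c μ(x₀+y+u)(x₀+y+u) + (y+u)ζ = const + u ζ₁ + c μ(u) z
  + c μ(u) u` (`z = x₀ + y`) for `μ` additive on `B(S',ρ₄)`;
* `exists_tiny_regular_bohr` — the localisation with the explicit radius window for `ρ₆`.

References: [GreenTao2008U3Inverse] arXiv:math/0503014, Lemma 21, §10 (Prop. 54), §12 (proof of Thm. 68).
-/

noncomputable section

namespace Summit.Parity.GeneralizedHardyLittlewood.GreenTaoLevelTwoGITwoCyclicInverse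

open Finset ZMod
open Literature.NumberTheory.Sieve

variable {N : ℕ} [NeZero N]

/-- **arXiv Lemma 21 (ii) + pigeonhole.**  If `B = B(S,ρ)` is regular, `0 < ε ≤ 1/(100 d)` (`d = #S`,
`S ≠ ∅`), `A ≠ ∅` consists of `ε ρ`-small shifts, `‖G‖ ≤ 1` and `K · #B ≤ ‖∑_{x ∈ B} G x‖`, then some
`x ∈ B` has `(K − 200 d ε) · #A ≤ ‖∑_{y ∈ A} G (x + y)‖` (for any finset `A` of `ερ`-small shifts).
[cite: GreenTao2008U3Inverse, Lemma 21 (ii) and §12, proof of Thm. 68] -/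
theorem exists_translate_correlation_of_regular (S : Finset (ZMod N)) (hS : S.Nonempty)
    {ρ ε : ℝ} (hρ : 0 < ρ) (hε0 : 0 < ε) (hε100 : ε ≤ 1 / (100 * (#S : ℝ)))
    (hreg : ∀ r : ℝ, |r| ≤ 1 / (100 * (#S : ℝ)) →
      (1 - 100 * (#S : ℝ) * |r|) * #{x : ZMod N | ∀ ξ ∈ S, ‖ZMod.toAddCircle (x * ξ)‖ < ρ} ≤
          #{x : ZMod N | ∀ ξ ∈ S, ‖ZMod.toAddCircle (x * ξ)‖ < (1 + r) * ρ} ∧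
        (#{x : ZMod N | ∀ ξ ∈ S, ‖ZMod.toAddCircle (x * ξ)‖ < (1 + r) * ρ} : ℝ) ≤
          (1 + 100 * (#S : ℝ) * |r|) * #{x : ZMod N | ∀ ξ ∈ S, ‖ZMod.toAddCircle (x * ξ)‖ < ρ})
    {A : Finset (ZMod N)} (hA : ∀ y ∈ A, ∀ ξ ∈ S, ‖ZMod.toAddCircle (y * ξ)‖ ≤ ε * ρ)
    (G : ZMod N → ℂ) (hG : ∀ x, ‖G x‖ ≤ 1) {K : ℝ}
    (hK : K * #{x : ZMod N | ∀ ξ ∈ S, ‖ZMod.toAddCircle (x * ξ)‖ < ρ} ≤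
      ‖∑ x ∈ ({x : ZMod N | ∀ ξ ∈ S, ‖ZMod.toAddCircle (x * ξ)‖ < ρ} : Finset (ZMod N)), G x‖) :
    ∃ x ∈ ({x : ZMod N | ∀ ξ ∈ S, ‖ZMod.toAddCircle (x * ξ)‖ < ρ} : Finset (ZMod N)),
      (K - 200 * (#S : ℝ) * ε) * #A ≤ ‖∑ y ∈ A, G (x + y)‖ := by
  classical
  set B : Finset (ZMod N) := {x : ZMod N | ∀ ξ ∈ S, ‖ZMod.toAddCircle (x * ξ)‖ < ρ} with hBdef
  have hB : ∀ x, x ∈ B ↔ ∀ ξ ∈ S, ‖ZMod.toAddCircle (x * ξ)‖ < ρ := fun x => by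
    rw [hBdef, mem_filter]; simp
  set Bp : Finset (ZMod N) := {x : ZMod N | ∀ ξ ∈ S, ‖ZMod.toAddCircle (x * ξ)‖ < (1 + ε) * ρ}
    with hBpdef
  set Bm : Finset (ZMod N) := {x : ZMod N | ∀ ξ ∈ S, ‖ZMod.toAddCircle (x * ξ)‖ < (1 - ε) * ρ}
    with hBmdef
  have hBp : ∀ x, x ∈ Bp ↔ ∀ ξ ∈ S, ‖ZMod.toAddCircle (x * ξ)‖ < (1 + ε) * ρ := fun x => by
    rw [hBpdef, mem_filter]; simp
  have hBm : ∀ x, x ∈ Bm ↔ ∀ ξ ∈ S, ‖ZMod.toAddCircle (x * ξ)‖ < (1 - ε) * ρ := fun x => by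
    rw [hBmdef, mem_filter]; simp
  have hregp : (#Bp : ℝ) ≤ (1 + 100 * (#S : ℝ) * ε) * #B := by
    have h := (hreg ε (by rw [abs_of_pos hε0]; exact hε100)).2
    rw [abs_of_pos hε0] at h; exact h
  have hregm : (1 - 100 * (#S : ℝ) * ε) * #B ≤ (#Bm : ℝ) := by
    have h := (hreg (-ε) (by rw [abs_neg, abs_of_pos hε0]; exact hε100)).1
    rw [abs_neg, abs_of_pos hε0, ← sub_eq_add_neg] at h; exact h
  have hBne : B.Nonempty := ⟨0, (hB 0).2 fun ξ _ => by rw [zero_mul, map_zero, norm_zero]; exact hρ⟩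
  have hBpos : (0 : ℝ) < #B := by exact_mod_cast hBne.card_pos
  -- arXiv Lemma 21 (ii)
  have h21 := norm_sum_sub_sum_avg_le_of_regular hB hBp hBm hS hA hregp hregm hG
  -- lower bound for the double sum
  have hdouble : (K - 200 * (#S : ℝ) * ε) * #A * #B ≤ ‖∑ x ∈ B, ∑ y ∈ A, G (x + y)‖ := by
    have h1 : ‖(#A : ℂ) * ∑ x ∈ B, G x‖ = #A * ‖∑ x ∈ B, G x‖ := by
      rw [norm_mul, Complex.norm_natCast]
    have h2 := norm_sub_norm_le ((#A : ℂ) * ∑ x ∈ B, G x) (∑ x ∈ B, ∑ y ∈ A, G (x + y))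
    rw [h1] at h2
    have h3 : (#A : ℝ) * (K * #B) ≤ #A * ‖∑ x ∈ B, G x‖ :=
      mul_le_mul_of_nonneg_left hK (Nat.cast_nonneg _)
    nlinarith
  -- pigeonhole over `x ∈ B`
  have htri : ‖∑ x ∈ B, ∑ y ∈ A, G (x + y)‖ ≤ ∑ x ∈ B, ‖∑ y ∈ A, G (x + y)‖ := norm_sum_le _ _
  obtain ⟨x, hx, hbest⟩ := exists_max_image B (fun x => ‖∑ y ∈ A, G (x + y)‖) hBne
  refine ⟨x, hx, ?_⟩
  have hmax : ∑ x' ∈ B, ‖∑ y ∈ A, G (x' + y)‖ ≤ #B * ‖∑ y ∈ A, G (x + y)‖ := by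
    calc ∑ x' ∈ B, ‖∑ y ∈ A, G (x' + y)‖ ≤ ∑ _x' ∈ B, ‖∑ y ∈ A, G (x + y)‖ :=
          sum_le_sum fun x' hx' => hbest x' hx'
      _ = #B * ‖∑ y ∈ A, G (x + y)‖ := by rw [sum_const, nsmul_eq_mul]
  have hfin : (K - 200 * (#S : ℝ) * ε) * #A * #B ≤ #B * ‖∑ y ∈ A, G (x + y)‖ :=
    hdouble.trans (htri.trans hmax)
  by_contra hcon
  push Not at hcon
  have : #B * ‖∑ y ∈ A, G (x + y)‖ < (K - 200 * (#S : ℝ) * ε) * #A * #B := by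
    calc #B * ‖∑ y ∈ A, G (x + y)‖ < #B * ((K - 200 * (#S : ℝ) * ε) * #A) :=
          mul_lt_mul_of_pos_left hcon hBpos
      _ = (K - 200 * (#S : ℝ) * ε) * #A * #B := by ring
  linarith

/-- **The phase algebra of the localisation.**  If `μ` is additive on `B₄ = B(S',ρ₄)` and
`x₀, y, u, y + u ∈ B₄`, then `μ(x₀+(y+u)) = μx₀ + μy + μu`, so that
`e(cμ(x₀+(y+u))(x₀+(y+u))) e((y+u)ζ) = [e(c(μx₀+μy)(x₀+y)) e(yζ)] · e(u(c(μx₀+μy)+ζ)) · e(cμ(u)(x₀+y)) · e(cμ(u)u)`.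
[cite: GreenTao2008U3Inverse, §12, proof of Thm. 68 (reduction to the bracket phase)] -/
theorem stdAddChar_local_phase_split (S' : Finset (ZMod N)) {ρ₄ : ℝ} (μ : ZMod N → ZMod N)
    (hadd : ∀ x ∈ ({v : ZMod N | ∀ ξ ∈ S', ‖ZMod.toAddCircle (v * ξ)‖ < ρ₄} : Finset (ZMod N)),
      ∀ h ∈ ({v : ZMod N | ∀ ξ ∈ S', ‖ZMod.toAddCircle (v * ξ)‖ < ρ₄} : Finset (ZMod N)),
        μ (x + h) = μ x + μ h)
    (c : ZMod N) {x₀ y u : ZMod N}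
    (hx₀ : x₀ ∈ ({v : ZMod N | ∀ ξ ∈ S', ‖ZMod.toAddCircle (v * ξ)‖ < ρ₄} : Finset (ZMod N)))
    (hy : y ∈ ({v : ZMod N | ∀ ξ ∈ S', ‖ZMod.toAddCircle (v * ξ)‖ < ρ₄} : Finset (ZMod N)))
    (hu : u ∈ ({v : ZMod N | ∀ ξ ∈ S', ‖ZMod.toAddCircle (v * ξ)‖ < ρ₄} : Finset (ZMod N)))
    (hyu : y + u ∈ ({v : ZMod N | ∀ ξ ∈ S', ‖ZMod.toAddCircle (v * ξ)‖ < ρ₄} : Finset (ZMod N)))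
    (ζ : ZMod N) :
    (stdAddChar (c * μ (x₀ + (y + u)) * (x₀ + (y + u))) : ℂ) * stdAddChar ((y + u) * ζ) =
      ((stdAddChar (c * (μ x₀ + μ y) * (x₀ + y)) : ℂ) * stdAddChar (y * ζ)) *
        ((stdAddChar (u * (c * (μ x₀ + μ y) + ζ)) : ℂ) * stdAddChar (c * μ u * (x₀ + y)) *
          stdAddChar (c * μ u * u)) := by
  have h1 : μ (x₀ + (y + u)) = μ x₀ + μ y + μ u := by
    rw [hadd x₀ hx₀ (y + u) hyu, hadd y hy u hu, add_assoc]
  rw [h1]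
  simp only [← AddChar.map_add_eq_mul]
  congr 1
  ring

/-- **Localisation to a tiny regular Bohr set (arXiv §12, proof of Thm. 68, with §10).**  Let `S' ≠ ∅`
(`d = #S'`), `0 < k ≤ 1`, `B(S',ρ₅)` regular with `0 < ρ₅`, `‖G‖ ≤ 1` and
`(k/16) #B(S',ρ₅) ≤ ‖∑_{w ∈ B(S',ρ₅)} G w‖`.  Then there are a radius
`ρ₆ ∈ [kρ₅/(12800 d³ 2^{d(d+2)}), kρ₅/(6400 d³ 2^{d(d+2)})]` with `B(S',ρ₆)` regular and `y ∈ B(S',ρ₅)` with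
`(k/32) #B(S',ρ₆) ≤ ‖∑_{u ∈ B(S',ρ₆)} G (y + u)‖`.
[cite: GreenTao2008U3Inverse, §12, proof of Thm. 68] -/
theorem exists_tiny_regular_bohr (S' : Finset (ZMod N)) (hS' : S'.Nonempty) {k ρ₅ : ℝ}
    (hk0 : 0 < k) (hk1 : k ≤ 1) (hρ₅ : 0 < ρ₅)
    (hreg₅ : ∀ r : ℝ, |r| ≤ 1 / (100 * (#S' : ℝ)) →
      (1 - 100 * (#S' : ℝ) * |r|) * #{x : ZMod N | ∀ ξ ∈ S', ‖ZMod.toAddCircle (x * ξ)‖ < ρ₅} ≤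
          #{x : ZMod N | ∀ ξ ∈ S', ‖ZMod.toAddCircle (x * ξ)‖ < (1 + r) * ρ₅} ∧
        (#{x : ZMod N | ∀ ξ ∈ S', ‖ZMod.toAddCircle (x * ξ)‖ < (1 + r) * ρ₅} : ℝ) ≤
          (1 + 100 * (#S' : ℝ) * |r|) * #{x : ZMod N | ∀ ξ ∈ S', ‖ZMod.toAddCircle (x * ξ)‖ < ρ₅})
    (G : ZMod N → ℂ) (hG : ∀ x, ‖G x‖ ≤ 1)
    (hbig : k / 16 * #{x : ZMod N | ∀ ξ ∈ S', ‖ZMod.toAddCircle (x * ξ)‖ < ρ₅} ≤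
      ‖∑ w ∈ ({x : ZMod N | ∀ ξ ∈ S', ‖ZMod.toAddCircle (x * ξ)‖ < ρ₅} : Finset (ZMod N)), G w‖) :
    ∃ (ρ₆ : ℝ) (y : ZMod N),
      y ∈ ({x : ZMod N | ∀ ξ ∈ S', ‖ZMod.toAddCircle (x * ξ)‖ < ρ₅} : Finset (ZMod N)) ∧ 0 < ρ₆ ∧
      k * ρ₅ / (12800 * (#S' : ℝ) * 2 ^ (#S' * (#S' + 2)) * (#S' : ℝ) ^ 2) ≤ ρ₆ ∧
      ρ₆ ≤ k * ρ₅ / (6400 * (#S' : ℝ) * 2 ^ (#S' * (#S' + 2)) * (#S' : ℝ) ^ 2) ∧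
      (∀ r : ℝ, |r| ≤ 1 / (100 * (#S' : ℝ)) →
        (1 - 100 * (#S' : ℝ) * |r|) * #{x : ZMod N | ∀ ξ ∈ S', ‖ZMod.toAddCircle (x * ξ)‖ < ρ₆} ≤
            #{x : ZMod N | ∀ ξ ∈ S', ‖ZMod.toAddCircle (x * ξ)‖ < (1 + r) * ρ₆} ∧
          (#{x : ZMod N | ∀ ξ ∈ S', ‖ZMod.toAddCircle (x * ξ)‖ < (1 + r) * ρ₆} : ℝ) ≤
            (1 + 100 * (#S' : ℝ) * |r|) *
              #{x : ZMod N | ∀ ξ ∈ S', ‖ZMod.toAddCircle (x * ξ)‖ < ρ₆}) ∧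
      k / 32 * #{x : ZMod N | ∀ ξ ∈ S', ‖ZMod.toAddCircle (x * ξ)‖ < ρ₆} ≤
        ‖∑ u ∈ ({x : ZMod N | ∀ ξ ∈ S', ‖ZMod.toAddCircle (x * ξ)‖ < ρ₆} : Finset (ZMod N)),
          G (y + u)‖ := by
  classical
  have hd1 : (1 : ℝ) ≤ #S' := by exact_mod_cast Nat.one_le_iff_ne_zero.mpr (card_pos.mpr hS').ne'
  have hd0 : (0 : ℝ) < #S' := by linarith
  have hpow1 : (1 : ℝ) ≤ 2 ^ (#S' * (#S' + 2)) := one_le_pow₀ (by norm_num)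
  have hbig1 : (1 : ℝ) ≤ 2 ^ (#S' * (#S' + 2)) * (#S' : ℝ) ^ 2 := by
    have h2 : (1 : ℝ) ≤ (#S' : ℝ) ^ 2 := by nlinarith
    calc (1 : ℝ) = 1 * 1 := by ring
      _ ≤ 2 ^ (#S' * (#S' + 2)) * (#S' : ℝ) ^ 2 := mul_le_mul hpow1 h2 zero_le_one (by positivity)
  -- the radius window
  obtain ⟨m₆, hm₆⟩ : ∃ m₆ : ℝ, m₆ = k * ρ₅ / (6400 * (#S' : ℝ) * 2 ^ (#S' * (#S' + 2)) * (#S' : ℝ) ^ 2) :=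
    ⟨_, rfl⟩
  have hm₆0 : 0 < m₆ := by rw [hm₆]; positivity
  obtain ⟨ρ₆, hρ₆lo, hρ₆hi, hreg₆⟩ := exists_regular_bohr S' (ε := m₆ / 2) (by linarith)
  have hρ₆0 : 0 < ρ₆ := by linarith
  -- the relative size of the shifts
  obtain ⟨ε', hε'⟩ : ∃ ε' : ℝ, ε' = ρ₆ / ρ₅ := ⟨_, rfl⟩
  have hε'0 : 0 < ε' := by rw [hε']; positivity
  have hε'le : ε' ≤ k / (6400 * (#S' : ℝ)) := by
    rw [hε', div_le_iff₀ hρ₅]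
    calc ρ₆ ≤ m₆ := by linarith
      _ = k * ρ₅ / (6400 * (#S' : ℝ)) / (2 ^ (#S' * (#S' + 2)) * (#S' : ℝ) ^ 2) := by
          rw [hm₆, div_div]; congr 1; ring
      _ ≤ k * ρ₅ / (6400 * (#S' : ℝ)) := div_le_self (by positivity) hbig1
      _ = k / (6400 * (#S' : ℝ)) * ρ₅ := by ring
  have hε'100 : ε' ≤ 1 / (100 * (#S' : ℝ)) := by
    refine hε'le.trans ?_
    rw [div_le_div_iff₀ (by positivity) (by positivity)]
    nlinarith
  have h200 : 200 * (#S' : ℝ) * ε' ≤ k / 32 := by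
    calc 200 * (#S' : ℝ) * ε' ≤ 200 * (#S' : ℝ) * (k / (6400 * (#S' : ℝ))) :=
          mul_le_mul_of_nonneg_left hε'le (by positivity)
      _ = k / 32 := by field_simp; ring
  -- the shifts `A = B(S',ρ₆)` are `ε'ρ₅`-small
  have hA : ∀ y ∈ ({x : ZMod N | ∀ ξ ∈ S', ‖ZMod.toAddCircle (x * ξ)‖ < ρ₆} : Finset (ZMod N)),
      ∀ ξ ∈ S', ‖ZMod.toAddCircle (y * ξ)‖ ≤ ε' * ρ₅ := by
    intro y hy ξ hξ
    rw [mem_filter] at hy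
    have e : ε' * ρ₅ = ρ₆ := by rw [hε']; field_simp
    rw [e]; exact (hy.2 ξ hξ).le
  obtain ⟨y, hy, hcorr⟩ := exists_translate_correlation_of_regular S' hS' hρ₅ hε'0 hε'100 hreg₅
    hA G hG hbig
  refine ⟨ρ₆, y, hy, hρ₆0, ?_, ?_, hreg₆, ?_⟩
  · calc k * ρ₅ / (12800 * (#S' : ℝ) * 2 ^ (#S' * (#S' + 2)) * (#S' : ℝ) ^ 2) = m₆ / 2 := by
          rw [hm₆]; field_simp; ring
      _ ≤ ρ₆ := hρ₆lo
  · calc ρ₆ ≤ 2 * (m₆ / 2) := hρ₆hi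
      _ = k * ρ₅ / (6400 * (#S' : ℝ) * 2 ^ (#S' * (#S' + 2)) * (#S' : ℝ) ^ 2) := by rw [hm₆]; ring
  · have hA0 : (0 : ℝ) ≤ #{x : ZMod N | ∀ ξ ∈ S', ‖ZMod.toAddCircle (x * ξ)‖ < ρ₆} := Nat.cast_nonneg _
    calc k / 32 * #{x : ZMod N | ∀ ξ ∈ S', ‖ZMod.toAddCircle (x * ξ)‖ < ρ₆}
        ≤ (k / 16 - 200 * (#S' : ℝ) * ε') * #{x : ZMod N | ∀ ξ ∈ S', ‖ZMod.toAddCircle (x * ξ)‖ < ρ₆} :=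
          mul_le_mul_of_nonneg_right (by linarith) hA0
      _ ≤ _ := hcorr

end Summit.Parity.GeneralizedHardyLittlewood.GreenTaoLevelTwoGITwoCyclicInverse
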